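import Summits.NavierStokesRegularity.NavierStokesRegularity.Theorems.TerminalTraceExtinctApexPairing
import HarnessLib

/-!
# Crux `TerminalTrace.TypeITraceScarL3` (stmt-NavierStokesRegularity-18385), line `extinct-apex`,
# STUB 2 support file 2: the UNIFORM MODULUS of the time pairings of a suitable weak solution in a
# backward parabolic ball, in terms of Albritton–Barker's `A` and the `L^{3/2}` norm of the pressure

Prover seat nsreg-p4 (gen 15); `--supports stmt-NavierStokesRegularity-18385`.  Theorems only;
continuation of `Theorems/TerminalTraceExtinctApexPairing.lean`.

For `(u, p)` in Albritton–Barker's class Def. 2.1 on `Q(z, R) = I × B` (`IsSuitableWeakSolutionInBall`)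
with `∫_B |u(τ)|² ≤ A` for a.e. `τ ∈ I` and `‖p‖_{L^{3/2}(Q(z,R))} ≤ P_q`, a test field `η` on `B`
with `‖Dη‖ ≤ K₁`, `‖Δη‖ ≤ K₂`, and the top value `L = lim_{s ↑ z.1} ∫_B ⟪u(s), η⟫`:
`|∫_B ⟪u(s), η⟫ − L| ≤ (K₁ A + K₂ (|B| + A)) (z.1 − s) + 3 K₁ P_q |B|^{1/3} (z.1 − s)^{1/3}` for
a.e. `s ∈ I` (`ae_abs_pairing_sub_top_le`; the remainder bound `integral_abs_remainder_le` uses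
`|u| ≤ 1 + |u|²` and Hölder `L¹ ⊂ L^{3/2}` on the box `]s, z.1[ × B`).  The modulus depends on the
pair only through `A` and `P_q`, hence is UNIFORM along a blow-up sequence with bounded
Albritton–Barker quantity `𝐈` and unit-ball-normalised pressures (Seregin, *Lecture notes on
regularity theory for the Navier–Stokes equations* (2014), Prop. 6.20; Robinson–Rodrigo–Sadowski
2016, Lemma 13.8).

WHAT THIS IS NOT: not a regularity or blow-up claim — time-regularity bookkeeping of weak
solutions; the crux `TypeITraceScarL3` and its open stub `stub_no_extinctApex` are untouched.
-/

noncomputable section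

open MeasureTheory Set Function Filter Topology TopologicalSpace Metric intervalIntegral
open scoped NNReal ENNReal InnerProductSpace RealInnerProductSpace Laplacian

namespace Summit.NavierStokesRegularity.NavierStokesRegularity.Theorems.TerminalTraceExtinctApexPairing

open Literature.Analysis Literature.Analysis.FluidPDE

variable {u : ℝ → (EuclideanSpace ℝ (Fin 3)) → (EuclideanSpace ℝ (Fin 3))} {p : ℝ → (EuclideanSpace ℝ (Fin 3)) → ℝ}
  {z : ℝ × (EuclideanSpace ℝ (Fin 3))} {R : ℝ}

/-! ## The uniform modulus of the increments -/

/-- **The modulus of the tested remainder.**  In Albritton–Barker's setting on `Q(z, R) = I × B`,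
if `∫_B |u(τ)|² ≤ A` for a.e. `τ ∈ I` and `‖p‖_{L^{3/2}(Q(z,R))} ≤ P_q`, then for a test field `η`
on `B` with `‖Dη‖ ≤ K₁`, `‖Δη‖ ≤ K₂` and every `s ∈ [z.1 − R², z.1[`,
`∫_s^{z.1} |f| ≤ (K₁ A + K₂ (|B| + A)) (z.1 − s) + 3 K₁ P_q |B|^{1/3} (z.1 − s)^{1/3}`
(`|u| ≤ 1 + |u|²`; Hölder `L¹ ⊂ L^{3/2}` on the box `]s, z.1[ × B`). -/
theorem integral_abs_remainder_le
    (hu : IntegrableOn (uncurry u) (parabolicCylinder R z) volume)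
    (hu2 : IntegrableOn (fun w => ‖uncurry u w‖ ^ 2) (parabolicCylinder R z) volume)
    (hpi : IntegrableOn (uncurry p) (parabolicCylinder R z) volume)
    {A : ℝ≥0∞} (hAtop : A ≠ ⊤)
    (hA : ∀ᵐ t ∂(volume.restrict (Ioo (z.1 - R ^ 2) z.1)), ∫⁻ x in ball z.2 R, ‖u t x‖ₑ ^ 2 ≤ A)
    {Pq : ℝ≥0∞} (hPqtop : Pq ≠ ⊤)
    (hPq : eLpNorm (uncurry p) (3 / 2) (volume.restrict (parabolicCylinder R z)) ≤ Pq)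
    {η : (EuclideanSpace ℝ (Fin 3)) → (EuclideanSpace ℝ (Fin 3))} (hη : FunctionSpaces.IsTestFunctionOn ⟨ball z.2 R, isOpen_ball⟩ η)
    {K₁ K₂ : ℝ} (hK₁ : ∀ x, ‖fderiv ℝ η x‖ ≤ K₁) (hK₂ : ∀ x, ‖Δ η x‖ ≤ K₂)
    {s : ℝ} (hs : s ∈ Ico (z.1 - R ^ 2) z.1) :
    ∫ t in Ioo s z.1, |∫ x in ball z.2 R, (⟪u t x, fderiv ℝ η x (u t x)⟫ + ⟪u t x, Δ η x⟫ +
        p t x * VectorCalculus.divergence η x)| ≤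
      (K₁ * A.toReal + K₂ * ((volume (ball z.2 R)).toReal + A.toReal)) * (z.1 - s) +
        3 * K₁ * Pq.toReal * (volume (ball z.2 R)).toReal ^ (1 / 3 : ℝ) * (z.1 - s) ^ (1 / 3 : ℝ) := by
  have hη2 : ContDiff ℝ 2 η := hη.contDiff.of_le (by norm_cast)
  have hK₁0 : 0 ≤ K₁ := (norm_nonneg _).trans (hK₁ 0)
  have hK₂0 : 0 ≤ K₂ := (norm_nonneg _).trans (hK₂ 0)
  have hσ : 0 < z.1 - s := by linarith [hs.2]
  set σ : ℝ := z.1 - s with hσdef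
  set B : Set (EuclideanSpace ℝ (Fin 3)) := ball z.2 R with hB
  set VB : ℝ≥0∞ := volume B with hVB
  have hVBtop : VB ≠ ⊤ := measure_ball_lt_top.ne
  set box : Set (ℝ × (EuclideanSpace ℝ (Fin 3))) := Ioo s z.1 ×ˢ B with hbox
  have hboxQ : box ⊆ parabolicCylinder R z := prod_mono (Ioo_subset_Ioo_left hs.1) subset_rfl
  have hboxm : MeasurableSet box := measurableSet_Ioo.prod measurableSet_ball
  have hvolbox : volume box = ENNReal.ofReal σ * VB := by rw [hbox, volume_Ioo_prod_ball]
  have hvolbox_top : volume box ≠ ⊤ := by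
    rw [hvolbox]; exact ENNReal.mul_ne_top ENNReal.ofReal_ne_top hVBtop
  haveI : IsFiniteMeasure ((volume : Measure (ℝ × (EuclideanSpace ℝ (Fin 3)))).restrict box) :=
    ⟨by rw [Measure.restrict_apply_univ]; exact hvolbox_top.lt_top⟩
  have hμbox : (volume : Measure (ℝ × (EuclideanSpace ℝ (Fin 3)))).restrict box =
      ((volume : Measure ℝ).restrict (Ioo s z.1)).prod ((volume : Measure (EuclideanSpace ℝ (Fin 3))).restrict B) := by
    rw [hbox, Measure.volume_eq_prod, Measure.prod_restrict]
  -- the remainder and its domination on the box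
  set F : ℝ × (EuclideanSpace ℝ (Fin 3)) → ℝ := fun w => ⟪u w.1 w.2, fderiv ℝ η w.2 (u w.1 w.2)⟫ + ⟪u w.1 w.2, Δ η w.2⟫ +
    p w.1 w.2 * VectorCalculus.divergence η w.2 with hFdef
  obtain ⟨iF, hFle⟩ := integrable_remainder_test hu hu2 hpi hη2 hK₁ hK₂
  have iFb : Integrable F (volume.restrict box) := iF.mono_measure (Measure.restrict_mono hboxQ le_rfl)
  have hub : IntegrableOn (uncurry u) box volume := hu.mono_set hboxQ
  have hu2b : IntegrableOn (fun w => ‖uncurry u w‖ ^ 2) box volume := hu2.mono_set hboxQ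
  have hpb : IntegrableOn (uncurry p) box volume := hpi.mono_set hboxQ
  -- Step 1: `∫_s^{z.1} |f| ≤ ∫∫_box |F|`
  have iFb' : Integrable F (((volume : Measure ℝ).restrict (Ioo s z.1)).prod
      ((volume : Measure (EuclideanSpace ℝ (Fin 3))).restrict B)) := by rw [← hμbox]; exact iFb
  have step1 : ∫ t in Ioo s z.1, |∫ x in B, F (t, x)| ≤ ∫ w in box, ‖F w‖ := by
    rw [hμbox, integral_prod _ iFb'.norm]
    refine integral_mono_ae (iFb'.integral_prod_left.norm) iFb'.norm.integral_prod_left ?_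
    exact Eventually.of_forall fun t => by
      dsimp only
      rw [← Real.norm_eq_abs]
      exact norm_integral_le_integral_norm _
  -- Step 2: `∫∫_box |F| ≤ K₁ ∫∫|u|² + K₂ ∫∫|u| + 3K₁ ∫∫|p|`
  have step2 : ∫ w in box, ‖F w‖ ≤
      K₁ * (∫ w in box, ‖uncurry u w‖ ^ 2) + K₂ * (∫ w in box, ‖uncurry u w‖) +
        3 * K₁ * ∫ w in box, ‖uncurry p w‖ := by
    have iA : Integrable (fun w => K₁ * ‖uncurry u w‖ ^ 2) (volume.restrict box) := hu2b.const_mul K₁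
    have iB : Integrable (fun w => K₂ * ‖uncurry u w‖) (volume.restrict box) := hub.norm.const_mul K₂
    have iC : Integrable (fun w => 3 * K₁ * ‖uncurry p w‖) (volume.restrict box) :=
      hpb.norm.const_mul _
    have iAB : Integrable (fun w => K₁ * ‖uncurry u w‖ ^ 2 + K₂ * ‖uncurry u w‖)
        (volume.restrict box) := iA.add iB
    have hrhs : Integrable (fun w => K₁ * ‖uncurry u w‖ ^ 2 + K₂ * ‖uncurry u w‖ +
        3 * K₁ * ‖uncurry p w‖) (volume.restrict box) := iAB.add iC
    calc ∫ w in box, ‖F w‖ ≤ ∫ w in box, (K₁ * ‖uncurry u w‖ ^ 2 + K₂ * ‖uncurry u w‖ +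
          3 * K₁ * ‖uncurry p w‖) := integral_mono_ae iFb.norm hrhs (Eventually.of_forall hFle)
      _ = K₁ * (∫ w in box, ‖uncurry u w‖ ^ 2) + K₂ * (∫ w in box, ‖uncurry u w‖) +
          3 * K₁ * ∫ w in box, ‖uncurry p w‖ := by
          rw [integral_add iAB iC, integral_add iA iB, MeasureTheory.integral_const_mul,
            MeasureTheory.integral_const_mul, MeasureTheory.integral_const_mul]
  -- Step 3: `∫∫_box |u|² ≤ A σ`
  have hum : AEStronglyMeasurable (uncurry u) (volume.restrict box) := hub.1
  have hlin2 : ∫⁻ w in box, ‖uncurry u w‖ₑ ^ 2 ≤ A * ENNReal.ofReal σ := by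
    have hm2 : AEMeasurable (fun w : ℝ × (EuclideanSpace ℝ (Fin 3)) => ‖uncurry u w‖ₑ ^ 2)
        (((volume : Measure ℝ).restrict (Ioo s z.1)).prod ((volume : Measure (EuclideanSpace ℝ (Fin 3))).restrict B)) := by
      rw [← hμbox]; exact hum.enorm.pow_const 2
    rw [hμbox, lintegral_prod _ hm2]
    have hA' : ∀ᵐ t ∂(volume.restrict (Ioo s z.1)), ∫⁻ x in B, ‖u t x‖ₑ ^ 2 ≤ A :=
      ae_restrict_of_ae_restrict_of_subset (Ioo_subset_Ioo_left hs.1) hA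
    calc ∫⁻ t in Ioo s z.1, ∫⁻ x in B, ‖uncurry u (t, x)‖ₑ ^ 2
        ≤ ∫⁻ _t in Ioo s z.1, A := lintegral_mono_ae hA'
      _ = A * ENNReal.ofReal σ := by
          rw [lintegral_const, Measure.restrict_apply_univ, Real.volume_Ioo]
  have step3 : ∫ w in box, ‖uncurry u w‖ ^ 2 ≤ A.toReal * σ := by
    rw [integral_eq_lintegral_of_nonneg_ae (Eventually.of_forall fun w => sq_nonneg _) (hum.norm.pow 2)]
    have e : ∫⁻ w in box, ENNReal.ofReal (‖uncurry u w‖ ^ 2) = ∫⁻ w in box, ‖uncurry u w‖ₑ ^ 2 :=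
      lintegral_congr fun w => by
        rw [ENNReal.ofReal_pow (norm_nonneg _), ofReal_norm]
    rw [e, ← ENNReal.toReal_ofReal hσ.le, ← ENNReal.toReal_mul]
    exact ENNReal.toReal_mono (ENNReal.mul_ne_top hAtop ENNReal.ofReal_ne_top) hlin2
  -- Step 4: `∫∫_box |u| ≤ |box| + ∫∫_box |u|²`
  have step4 : ∫ w in box, ‖uncurry u w‖ ≤ VB.toReal * σ + A.toReal * σ := by
    have hvol : (volume box).toReal = VB.toReal * σ := by
      rw [hvolbox, ENNReal.toReal_mul, ENNReal.toReal_ofReal hσ.le]; ring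
    calc ∫ w in box, ‖uncurry u w‖ ≤ ∫ w in box, (1 + ‖uncurry u w‖ ^ 2) :=
          integral_mono_ae hub.norm ((integrable_const _).add hu2b)
            (Eventually.of_forall fun w => by nlinarith [sq_nonneg (‖uncurry u w‖ - 1 / 2)])
      _ = (volume box).toReal + ∫ w in box, ‖uncurry u w‖ ^ 2 := by
          rw [integral_add (integrable_const _) hu2b, MeasureTheory.integral_const, smul_eq_mul, mul_one,
            measureReal_restrict_apply_univ, measureReal_def]
      _ ≤ VB.toReal * σ + A.toReal * σ := by rw [hvol]; gcongr
  -- Step 5: `∫∫_box |p| ≤ P_q |box|^{1/3}` (Hölder)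
  have step5 : ∫ w in box, ‖uncurry p w‖ ≤ Pq.toReal * VB.toReal ^ (1 / 3 : ℝ) * σ ^ (1 / 3 : ℝ) := by
    have hpm : AEStronglyMeasurable (uncurry p) (volume.restrict box) := hpb.1
    rw [integral_norm_eq_lintegral_enorm hpm]
    have h1 : ∫⁻ w in box, ‖uncurry p w‖ₑ = eLpNorm (uncurry p) 1 (volume.restrict box) := by
      rw [eLpNorm_one_eq_lintegral_enorm]
    have h2 : eLpNorm (uncurry p) 1 (volume.restrict box) ≤
        eLpNorm (uncurry p) (3 / 2) (volume.restrict box) * (volume box) ^ (1 / 3 : ℝ) := by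
      have h := eLpNorm_le_eLpNorm_mul_rpow_measure_univ (μ := volume.restrict box)
        (p := 1) (q := (3 / 2 : ℝ≥0∞))
        (by rw [ENNReal.le_div_iff_mul_le (by norm_num) (by norm_num)]; norm_num) hpm
      rw [Measure.restrict_apply_univ] at h
      have hexp : (1 / (1 : ℝ≥0∞).toReal - 1 / ((3 : ℝ≥0∞) / 2).toReal : ℝ) = 1 / 3 := by
        rw [ENNReal.toReal_one, ENNReal.toReal_div, ENNReal.toReal_ofNat, ENNReal.toReal_ofNat]
        norm_num
      rwa [hexp] at h
    have h3 : eLpNorm (uncurry p) (3 / 2) (volume.restrict box) ≤ Pq :=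
      (eLpNorm_mono_measure _ (Measure.restrict_mono hboxQ le_rfl)).trans hPq
    have h4 : ∫⁻ w in box, ‖uncurry p w‖ₑ ≤ Pq * (ENNReal.ofReal σ * VB) ^ (1 / 3 : ℝ) := by
      rw [h1, ← hvolbox]
      exact h2.trans (mul_le_mul' h3 le_rfl)
    have h5 : (Pq * (ENNReal.ofReal σ * VB) ^ (1 / 3 : ℝ)).toReal =
        Pq.toReal * VB.toReal ^ (1 / 3 : ℝ) * σ ^ (1 / 3 : ℝ) := by
      rw [ENNReal.toReal_mul, ← ENNReal.toReal_rpow, ENNReal.toReal_mul, ENNReal.toReal_ofReal hσ.le,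
        Real.mul_rpow hσ.le ENNReal.toReal_nonneg]
      ring
    rw [← h5]
    exact ENNReal.toReal_mono (ENNReal.mul_ne_top hPqtop
      (ENNReal.rpow_ne_top_of_nonneg (by norm_num)
        (ENNReal.mul_ne_top ENNReal.ofReal_ne_top hVBtop))) h4
  -- assembly
  have e0 : (fun t => |∫ x in ball z.2 R, (⟪u t x, fderiv ℝ η x (u t x)⟫ + ⟪u t x, Δ η x⟫ +
      p t x * VectorCalculus.divergence η x)|) = fun t => |∫ x in B, F (t, x)| := rfl
  rw [e0]
  calc ∫ t in Ioo s z.1, |∫ x in B, F (t, x)| ≤ ∫ w in box, ‖F w‖ := step1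
    _ ≤ K₁ * (∫ w in box, ‖uncurry u w‖ ^ 2) + K₂ * (∫ w in box, ‖uncurry u w‖) +
        3 * K₁ * ∫ w in box, ‖uncurry p w‖ := step2
    _ ≤ K₁ * (A.toReal * σ) + K₂ * (VB.toReal * σ + A.toReal * σ) +
        3 * K₁ * (Pq.toReal * VB.toReal ^ (1 / 3 : ℝ) * σ ^ (1 / 3 : ℝ)) := by
        gcongr
    _ = (K₁ * A.toReal + K₂ * (VB.toReal + A.toReal)) * σ +
        3 * K₁ * Pq.toReal * VB.toReal ^ (1 / 3 : ℝ) * σ ^ (1 / 3 : ℝ) := by ring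

/-- **The uniform modulus of the pairing from its top value** (Albritton–Barker's class Def. 2.1
on `Q(z, R)`, a.e.-energy bound `A`, `L^{3/2}` pressure bound `P_q`, test field `η` on the ball,
top value `L`): for a.e. `s` in the time window,
`|∫_B ⟪u(s), η⟫ − L| ≤ (K₁ A + K₂ (|B| + A)) (z.1 − s) + 3 K₁ P_q |B|^{1/3} (z.1 − s)^{1/3}`. -/
theorem ae_abs_pairing_sub_top_le (h : IsSuitableWeakSolutionInBall R z u p) (hR : 0 < R)
    {A : ℝ≥0∞} (hAtop : A ≠ ⊤)
    (hA : ∀ᵐ t ∂(volume.restrict (Ioo (z.1 - R ^ 2) z.1)), ∫⁻ x in ball z.2 R, ‖u t x‖ₑ ^ 2 ≤ A)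
    {Pq : ℝ≥0∞} (hPqtop : Pq ≠ ⊤)
    (hPq : eLpNorm (uncurry p) (3 / 2) (volume.restrict (parabolicCylinder R z)) ≤ Pq)
    {η : (EuclideanSpace ℝ (Fin 3)) → (EuclideanSpace ℝ (Fin 3))} (hη : FunctionSpaces.IsTestFunctionOn ⟨ball z.2 R, isOpen_ball⟩ η)
    {K₁ K₂ : ℝ} (hK₁ : ∀ x, ‖fderiv ℝ η x‖ ≤ K₁) (hK₂ : ∀ x, ‖Δ η x‖ ≤ K₂) {L : ℝ}
    (hL : Tendsto (fun s => ∫ x in ball z.2 R, ⟪u s x, η x⟫) (𝓝[<] z.1) (𝓝 L)) :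
    ∀ᵐ s ∂(volume.restrict (Ioo (z.1 - R ^ 2) z.1)),
      |(∫ x in ball z.2 R, ⟪u s x, η x⟫) - L| ≤
        (K₁ * A.toReal + K₂ * ((volume (ball z.2 R)).toReal + A.toReal)) * (z.1 - s) +
          3 * K₁ * Pq.toReal * (volume (ball z.2 R)).toReal ^ (1 / 3 : ℝ) * (z.1 - s) ^ (1 / 3 : ℝ) := by
  obtain ⟨hu, hu2, hpi⟩ := integrable_data h hAtop hA
  have hsol := h.1.distributional
  obtain ⟨-, hfI, hfaI⟩ := integrableOn_pairing_ball hu hu2 hpi hη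
  filter_upwards [ae_pairing_eq_top_sub_integral hsol hu hu2 hpi hR hη hL,
    ae_restrict_mem measurableSet_Ioo] with s hs hsI
  rw [hs, sub_sub_cancel_left, abs_neg]
  have hsz : s ≤ z.1 := hsI.2.le
  calc |∫ t in s..z.1, ∫ x in ball z.2 R, (⟪u t x, fderiv ℝ η x (u t x)⟫ + ⟪u t x, Δ η x⟫ +
          p t x * VectorCalculus.divergence η x)|
      ≤ ∫ t in s..z.1, |∫ x in ball z.2 R, (⟪u t x, fderiv ℝ η x (u t x)⟫ + ⟪u t x, Δ η x⟫ +
          p t x * VectorCalculus.divergence η x)| :=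
        intervalIntegral.abs_integral_le_integral_abs hsz
    _ = ∫ t in Ioo s z.1, |∫ x in ball z.2 R, (⟪u t x, fderiv ℝ η x (u t x)⟫ + ⟪u t x, Δ η x⟫ +
          p t x * VectorCalculus.divergence η x)| := by
        rw [intervalIntegral.integral_of_le hsz, setIntegral_congr_set Ioo_ae_eq_Ioc]
    _ ≤ _ := integral_abs_remainder_le hu hu2 hpi hAtop hA hPqtop hPq hη hK₁ hK₂ ⟨hsI.1.le, hsI.2⟩

end Summit.NavierStokesRegularity.NavierStokesRegularity.Theorems.TerminalTraceExtinctApexPairing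

end
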